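import Mathlib.Analysis.SpecialFunctions.Log.Basic
import Mathlib.Analysis.SpecialFunctions.Pow.Real
import Mathlib.Analysis.Complex.ExponentialBounds
import Mathlib.Order.Filter.AtTopBot.Basic
import HarnessLib

/-!
# Gel'fond's method for `e^{ξᵢηⱼ}`: the choice of the parameters and the comparison sequences

Topic `Literature/NumberTheory/Transcendental`. Fifth brick of the proof of the θ-forms
`ExpGridCore_iii` / `ExpGridCore_ii` of the Gel'fond–Tijdeman theorem (`ExpSmallTrdeg.lean`;
Baker 1975, Ch. 12, Theorem 12.1) by Gel'fond's method (Baker 1975, Ch. 12 §5). This file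
contains NO transcendence: only the elementary arithmetic of the parameters, isolated so that the
main argument (`ExpGridMain.lean`) can quote it.

At level `ℓ` the main argument uses `S = λℓ^{m-1}` points in each direction, multiplicity
`T = ℓ^{m+n}` (extrapolated to `T' = C·T`), frequencies in `[0, L]^m` with `L = μℓ^{n+1}`, and
coefficient degree `L₀ = νℓ^{m+n}`; at the power level every comparison of Gel'fond's method is then
an identity exactly when `mn = m + 2n` (Baker's case `m = n = 3`), and the method succeeds iff
three inequalities between the CONSTANTS `λ, μ, ν, C` hold: Siegel's count (S), Tijdeman's count
(Z) and the comparison with Gel'fond's criterion (G). `exists_params` PROVES that such constants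
exist whenever `m ≥ 3`, `n ≥ 2` (the key point being `n > 1 + n/m ⟺ mn > m + n`, which lets
`λ → ∞` win in (G) while `μ ≍ λ^{n/m}`). The second part provides the comparison sequences
`δ_N = K (N+2)^M`, `σ_N = K (N+2)^M log (N+2)` with the monotonicity and growth properties required
by the tree's `gelfond_criterion_not_small_values` (ratio constant `a = 2^{M+1}`), and small
real-analysis lemmas (`log ℓ ≤ ℓ^M`, `½ < log ℓ` for `ℓ ≥ 2`, …).

## References

* [BakerTNT1975] A. Baker, *Transcendental Number Theory*, CUP 1975, Ch. 12 §5, pp. 116–117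
  (the parameters `m, L₀, L, k` of the proof of Theorem 12.1).
-/

noncomputable section

open Filter Real

namespace Literature.NumberTheory.Transcendental

namespace ExpGrid

/-! ### The integer `μ` with `μ^m ≍ B` -/

/-- For `B ≥ 1`, `m ≥ 1` there is `μ ≥ 1` with `B ≤ μ^m ≤ 2^m B` (the least `μ` with `μ^m ≥ B`).
[folklore] -/
theorem exists_nat_pow_near {m : ℕ} (hm : 1 ≤ m) {B : ℕ} (hB : 1 ≤ B) :
    ∃ μ : ℕ, 1 ≤ μ ∧ B ≤ μ ^ m ∧ μ ^ m ≤ 2 ^ m * B := by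
  classical
  have hex : ∃ μ : ℕ, B ≤ μ ^ m := ⟨B, Nat.le_self_pow (by omega) B⟩
  refine ⟨Nat.find hex, ?_, Nat.find_spec hex, ?_⟩
  · by_contra h0
    push Not at h0
    have h1 : Nat.find hex = 0 := by omega
    have := Nat.find_spec hex
    rw [h1, zero_pow (by omega)] at this
    omega
  · set μ := Nat.find hex with hμ
    rcases Nat.lt_or_ge μ 2 with hlt | hge
    · have : μ ^ m ≤ 1 := by
        rcases Nat.lt_succ_iff.mp hlt |>.lt_or_eq with h | h
        · have : μ = 0 := by omega
          rw [this, zero_pow (by omega)]; exact zero_le_one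
        · rw [h, one_pow]
      calc μ ^ m ≤ 1 := this
        _ ≤ 2 ^ m * B := Nat.one_le_iff_ne_zero.mpr (Nat.mul_ne_zero (pow_ne_zero _ two_ne_zero) (by omega))
    · have hmin : ¬ B ≤ (μ - 1) ^ m := Nat.find_min hex (by omega)
      push Not at hmin
      calc μ ^ m ≤ (2 * (μ - 1)) ^ m := Nat.pow_le_pow_left (by omega) m
        _ = 2 ^ m * (μ - 1) ^ m := by rw [mul_pow]
        _ ≤ 2 ^ m * B := Nat.mul_le_mul_left _ hmin.le

/-! ### Existence of the constants `λ, μ, ν, C` -/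

/-- **The constants of Gel'fond's method for the grid** (`m ≥ 3`, `n ≥ 2`, `d ≥ 1`; `D₁, κ` the
degree constants of the presentation, `cT ≥ 0` Tijdeman's constant, `HX = Η·Ξ ≥ 0`): there are
positive integers `λ, μ, ν, C` satisfying
(S) `2dλⁿ(ν + D₁ + mn μλ D₁ + c₀) ≤ μ^m ν` (`c₀ = 1 + (2mn+m+1)κ`; Siegel's count),
(Z) `cT (2^m μ^m + λμ HX) < C λⁿ` (Tijdeman's count), and
(G) `40·2^{m+n+1}·K_δ·K_σ + 1 ≤ λⁿ` with `K_δ = d(ν + CD₁ + mnμλD₁ + (2mn+m+2)κ) + 1`,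
`K_σ = d(1+C)(n+2) + 1` (Gel'fond's criterion). PROVED: `C` is fixed first, then `λ` large,
`μ` least with `μ^m ≥ 4dλⁿ`, `ν = D₁(1 + mnμλ) + c₀`; (G) holds for large `λ` because
`m + n + 1 ≤ mn`. [cite: BakerTNT1975, Ch. 12 §5 p. 116] -/
theorem exists_params {m n d : ℕ} (hm : 3 ≤ m) (hn : 2 ≤ n) (hd : 1 ≤ d) (D₁ κ : ℕ)
    {cT HX : ℝ} (hcT : 0 ≤ cT) (hHX : 0 ≤ HX) :
    ∃ lam mu nu C : ℕ, 1 ≤ lam ∧ 1 ≤ mu ∧ 1 ≤ nu ∧ 1 ≤ C ∧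
      2 * d * lam ^ n * (nu + D₁ + m * n * (mu * lam) * D₁ + (1 + (2 * m * n + m + 1) * κ)) ≤
        mu ^ m * nu ∧
      cT * (2 ^ m * (mu : ℝ) ^ m + lam * mu * HX) < C * (lam : ℝ) ^ n ∧
      40 * 2 ^ (m + n + 1) *
          (d * (nu + C * D₁ + m * n * (mu * lam) * D₁ + (2 * m * n + m + 2) * κ) + 1) *
          (d * ((1 + C) * (n + 2)) + 1) + 1 ≤ lam ^ n := by
  -- the constants that do not depend on `λ`
  set cstar : ℝ := cT * 2 ^ (m + 2) * d * (2 ^ m + HX) with hcstar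
  have hcstar0 : 0 ≤ cstar := by rw [hcstar]; positivity
  set C : ℕ := ⌈cstar⌉₊ + 1 with hC
  set A : ℕ := 40 * 2 ^ (m + n + 1) with hA
  set Kσ : ℕ := d * ((1 + C) * (n + 2)) + 1 with hKσ
  set c₀ : ℕ := 1 + (2 * m * n + m + 1) * κ with hc₀
  set κ₂ : ℕ := (2 * m * n + m + 2) * κ with hκ₂
  set c₁ : ℕ := d * (D₁ + c₀ + C * D₁ + κ₂) + 1 with hc₁
  set K'' : ℕ := 4 * A * Kσ * d * m * n * D₁ with hK''
  -- `λ`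
  set lam : ℕ := max (K'' ^ m * 2 ^ (m + 2) * d) (2 * (A * Kσ * c₁ + 1)) with hlam
  have hlam2 : 2 * (A * Kσ * c₁ + 1) ≤ lam := le_max_right _ _
  have hlam1 : 1 ≤ lam := le_trans (by omega) hlam2
  have hlamK : K'' ^ m * 2 ^ (m + 2) * d ≤ lam := le_max_left _ _
  -- `μ`
  have h4d : 1 ≤ 4 * d * lam ^ n := Nat.one_le_iff_ne_zero.mpr (Nat.mul_ne_zero (by omega)
    (pow_ne_zero _ (by omega)))
  obtain ⟨mu, hmu1, hmuB, hmuB'⟩ := exists_nat_pow_near (m := m) (by omega) h4d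
  -- `ν`
  set nu : ℕ := D₁ + m * n * (mu * lam) * D₁ + c₀ with hnu
  have hnu1 : 1 ≤ nu := by rw [hnu, hc₀]; omega
  refine ⟨lam, mu, nu, C, hlam1, hmu1, hnu1, by rw [hC]; omega, ?_, ?_, ?_⟩
  · -- (S)
    have h2 : nu + D₁ + m * n * (mu * lam) * D₁ + (1 + (2 * m * n + m + 1) * κ) = 2 * nu := by
      rw [hnu, hc₀]; ring
    rw [h2]
    calc 2 * d * lam ^ n * (2 * nu) = (4 * d * lam ^ n) * nu := by ring
      _ ≤ mu ^ m * nu := Nat.mul_le_mul_right _ hmuB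
  · -- (Z): first `λ μ ≤ 2^{m+2} d λ^n`
    have hμm : mu ^ m ≤ 2 ^ (m + 2) * d * lam ^ n := by
      calc mu ^ m ≤ 2 ^ m * (4 * d * lam ^ n) := hmuB'
        _ = 2 ^ (m + 2) * d * lam ^ n := by rw [pow_add]; ring
    have hμ : mu ≤ 2 ^ (m + 2) * d * lam ^ (n - 1) := by
      have hm0 : m ≠ 0 := by omega
      rw [← Nat.pow_le_pow_iff_left hm0]
      refine hμm.trans ?_
      rw [mul_pow]
      refine Nat.mul_le_mul (Nat.le_self_pow hm0 _) ?_
      rw [← pow_mul]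
      have h3 : n ≤ (n - 1) * 3 := by omega
      exact Nat.pow_le_pow_right hlam1 (h3.trans (Nat.mul_le_mul_left _ hm))
    have hlm : lam * mu ≤ 2 ^ (m + 2) * d * lam ^ n := by
      calc lam * mu ≤ lam * (2 ^ (m + 2) * d * lam ^ (n - 1)) := Nat.mul_le_mul_left _ hμ
        _ = 2 ^ (m + 2) * d * (lam * lam ^ (n - 1)) := by ring
        _ = 2 ^ (m + 2) * d * lam ^ n := by rw [← pow_succ', Nat.sub_add_cancel (by omega)]
    have hμmR : (mu : ℝ) ^ m ≤ 2 ^ (m + 2) * d * (lam : ℝ) ^ n := by exact_mod_cast hμm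
    have hlmR : (lam : ℝ) * mu ≤ 2 ^ (m + 2) * d * (lam : ℝ) ^ n := by exact_mod_cast hlm
    have hln : (0 : ℝ) < (lam : ℝ) ^ n := pow_pos (by exact_mod_cast hlam1) n
    have hCge : cstar + 1 ≤ (C : ℝ) := by
      rw [hC]; push_cast; linarith [Nat.le_ceil cstar]
    calc cT * (2 ^ m * (mu : ℝ) ^ m + lam * mu * HX)
        ≤ cT * (2 ^ m * (2 ^ (m + 2) * d * (lam : ℝ) ^ n) + 2 ^ (m + 2) * d * (lam : ℝ) ^ n * HX) := by
          gcongr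
      _ = cstar * (lam : ℝ) ^ n := by rw [hcstar]; ring
      _ < (cstar + 1) * (lam : ℝ) ^ n := by nlinarith
      _ ≤ C * (lam : ℝ) ^ n := mul_le_mul_of_nonneg_right hCge hln.le
  · -- (G)
    have hKδ : d * (nu + C * D₁ + m * n * (mu * lam) * D₁ + (2 * m * n + m + 2) * κ) + 1 =
        2 * d * m * n * D₁ * (mu * lam) + c₁ := by
      rw [hnu, hc₁, hc₀, hκ₂]; ring
    rw [hKδ]
    -- the `μλ`-term: `K'' μ λ ≤ λ^n`
    have hμm : mu ^ m ≤ 2 ^ (m + 2) * d * lam ^ n := by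
      calc mu ^ m ≤ 2 ^ m * (4 * d * lam ^ n) := hmuB'
        _ = 2 ^ (m + 2) * d * lam ^ n := by rw [pow_add]; ring
    have hmain : K'' * (mu * lam) ≤ lam ^ n := by
      have hm0 : m ≠ 0 := by omega
      rw [← Nat.pow_le_pow_iff_left hm0, ← pow_mul]
      calc (K'' * (mu * lam)) ^ m = K'' ^ m * mu ^ m * lam ^ m := by rw [mul_pow, mul_pow]; ring
        _ ≤ K'' ^ m * (2 ^ (m + 2) * d * lam ^ n) * lam ^ m := by gcongr
        _ = (K'' ^ m * 2 ^ (m + 2) * d) * lam ^ (m + n) := by rw [pow_add]; ring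
        _ ≤ lam * lam ^ (m + n) := Nat.mul_le_mul_right _ hlamK
        _ = lam ^ (m + n + 1) := by rw [pow_succ']
        _ ≤ lam ^ (n * m) := Nat.pow_le_pow_right hlam1 (by nlinarith)
    have hsecond : 2 * (A * Kσ * c₁ + 1) ≤ lam ^ n :=
      hlam2.trans (Nat.le_self_pow (by omega) lam)
    have hfirst : 2 * (A * (2 * d * m * n * D₁ * (mu * lam)) * Kσ) ≤ lam ^ n := by
      calc 2 * (A * (2 * d * m * n * D₁ * (mu * lam)) * Kσ) = K'' * (mu * lam) := by rw [hK'']; ring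
        _ ≤ lam ^ n := hmain
    have key : 2 * (A * (2 * d * m * n * D₁ * (mu * lam) + c₁) * Kσ + 1) ≤ 2 * lam ^ n := by
      calc 2 * (A * (2 * d * m * n * D₁ * (mu * lam) + c₁) * Kσ + 1)
          = 2 * (A * (2 * d * m * n * D₁ * (mu * lam)) * Kσ) + 2 * (A * Kσ * c₁ + 1) := by ring
        _ ≤ lam ^ n + lam ^ n := Nat.add_le_add hfirst hsecond
        _ = 2 * lam ^ n := by ring
    change A * (2 * d * m * n * D₁ * (mu * lam) + c₁) * Kσ + 1 ≤ lam ^ n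
    exact Nat.le_of_mul_le_mul_left key (by norm_num)

/-! ### Small real-analysis lemmas -/

/-- `log ℓ ≤ ℓ^M` for `ℓ ≥ 1`, `M ≥ 1`. [folklore] -/
theorem log_le_pow {ℓ : ℝ} (hℓ : 1 ≤ ℓ) {M : ℕ} (hM : 1 ≤ M) : Real.log ℓ ≤ ℓ ^ M :=
  ((Real.log_le_sub_one_of_pos (by linarith)).trans (by linarith)).trans (le_self_pow₀ hℓ (by omega))

/-- `1/2 < log ℓ` for `ℓ ≥ 2`. [folklore] -/
theorem half_lt_log {ℓ : ℝ} (hℓ : 2 ≤ ℓ) : 1 / 2 < Real.log ℓ :=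
  lt_of_lt_of_le (by linarith [Real.log_two_gt_d9]) (Real.log_le_log two_pos hℓ)

/-- `0 < log ℓ` for `ℓ ≥ 2`. [folklore] -/
theorem log_pos_of_two_le {ℓ : ℝ} (hℓ : 2 ≤ ℓ) : 0 < Real.log ℓ := Real.log_pos (by linarith)

/-- `K < log ℓ` as soon as `exp K < ℓ`. [folklore] -/
theorem lt_log_of_exp_lt {K ℓ : ℝ} (h : Real.exp K < ℓ) : K < Real.log ℓ := by
  have hℓ : 0 < ℓ := (Real.exp_pos K).trans h
  exact (Real.lt_log_iff_exp_lt hℓ).mpr h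

/-- Junk absorption for the type: `β U < U V` when `β < V`, `0 < U`. [folklore] -/
theorem junk_lt_of_lt {β U V : ℝ} (hU : 0 < U) (h : β < V) : β * U < U * V := by nlinarith

/-- Junk absorption for the smallness: if `s ≤ -G V + k U₁ V`, `A U₂ + ℓ U₁ ≤ G`, `k < ℓ`,
`0 < U₁`, `0 < V`, then `s < -(A U₂ V)`. [folklore] -/
theorem small_of_gain {s G k U₁ U₂ A ℓ V : ℝ} (hs : s ≤ -(G * V) + k * U₁ * V)
    (hG : A * U₂ + ℓ * U₁ ≤ G) (hk : k < ℓ) (hU₁ : 0 < U₁) (hV : 0 < V) : s < -(A * U₂ * V) := by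
  nlinarith [mul_pos hU₁ hV]

/-! ### The comparison sequences of Gel'fond's criterion -/

/-- `δ_N = K (N+2)^M`. [folklore] -/
def deltaSeq (K : ℝ) (M : ℕ) (N : ℕ) : ℝ := K * ((N : ℝ) + 2) ^ M

/-- `σ_N = K (N+2)^M log (N+2)`. [folklore] -/
def sigmaSeq (K : ℝ) (M : ℕ) (N : ℕ) : ℝ := K * (((N : ℝ) + 2) ^ M * Real.log ((N : ℝ) + 2))

/-- `δ` is monotone (`K ≥ 0`). [folklore] -/
theorem deltaSeq_mono {K : ℝ} (hK : 0 ≤ K) (M : ℕ) : Monotone (deltaSeq K M) := by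
  intro a b hab
  unfold deltaSeq
  gcongr

/-- `σ` is monotone (`K ≥ 0`). [folklore] -/
theorem sigmaSeq_mono {K : ℝ} (hK : 0 ≤ K) (M : ℕ) : Monotone (sigmaSeq K M) := by
  intro a b hab
  unfold sigmaSeq
  have ha : (2 : ℝ) ≤ (a : ℝ) + 2 := by linarith [(Nat.cast_nonneg a : (0 : ℝ) ≤ a)]
  have hab' : (a : ℝ) + 2 ≤ (b : ℝ) + 2 := by exact_mod_cast Nat.add_le_add_right hab 2
  refine mul_le_mul_of_nonneg_left ?_ hK
  exact mul_le_mul (pow_le_pow_left₀ (by linarith) hab' M) (Real.log_le_log (by linarith) hab')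
    (log_pos_of_two_le ha).le (by positivity)

/-- `0 < δ_N` (`K > 0`). [folklore] -/
theorem deltaSeq_pos {K : ℝ} (hK : 0 < K) (M N : ℕ) : 0 < deltaSeq K M N := by
  unfold deltaSeq; positivity

/-- `0 < σ_N` (`K > 0`). [folklore] -/
theorem sigmaSeq_pos {K : ℝ} (hK : 0 < K) (M N : ℕ) : 0 < sigmaSeq K M N := by
  unfold sigmaSeq
  have hN : (2 : ℝ) ≤ (N : ℝ) + 2 := by linarith [(Nat.cast_nonneg N : (0 : ℝ) ≤ N)]
  exact mul_pos hK (mul_pos (by positivity) (log_pos_of_two_le hN))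

/-- `σ_N → ∞` (`K > 0`). [folklore] -/
theorem tendsto_sigmaSeq {K : ℝ} (hK : 0 < K) (M : ℕ) : Tendsto (sigmaSeq K M) atTop atTop := by
  -- `σ_N ≥ K log (N + 2) ≥ K log N`
  have h1 : Tendsto (fun N : ℕ => K * Real.log ((N : ℝ) + 2)) atTop atTop := by
    refine Tendsto.const_mul_atTop hK ?_
    refine Real.tendsto_log_atTop.comp ?_
    exact tendsto_atTop_add_const_right _ 2 tendsto_natCast_atTop_atTop
  refine tendsto_atTop_mono (fun N => ?_) h1
  unfold sigmaSeq
  have hN : (2 : ℝ) ≤ (N : ℝ) + 2 := by linarith [(Nat.cast_nonneg N : (0 : ℝ) ≤ N)]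
  have hlog : 0 ≤ Real.log ((N : ℝ) + 2) := (log_pos_of_two_le hN).le
  have hp : (1 : ℝ) ≤ ((N : ℝ) + 2) ^ M := one_le_pow₀ (by linarith)
  calc K * Real.log ((N : ℝ) + 2) = K * (1 * Real.log ((N : ℝ) + 2)) := by ring
    _ ≤ K * (((N : ℝ) + 2) ^ M * Real.log ((N : ℝ) + 2)) := by gcongr

/-- The ratio bound `δ_{N+1} ≤ 2^{M+1} δ_N` (`K ≥ 0`). [folklore] -/
theorem deltaSeq_succ_le {K : ℝ} (hK : 0 ≤ K) (M N : ℕ) :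
    deltaSeq K M (N + 1) ≤ 2 ^ (M + 1) * deltaSeq K M N := by
  unfold deltaSeq
  have hN : (0 : ℝ) ≤ N := Nat.cast_nonneg N
  have h1 : (((N + 1 : ℕ) : ℝ) + 2) ^ M ≤ 2 ^ M * (((N : ℝ) + 2) ^ M) := by
    rw [← mul_pow]; push_cast
    exact pow_le_pow_left₀ (by linarith) (by linarith) M
  calc K * (((N + 1 : ℕ) : ℝ) + 2) ^ M ≤ K * (2 ^ M * ((N : ℝ) + 2) ^ M) :=
        mul_le_mul_of_nonneg_left h1 hK
    _ = 1 * (2 ^ M * (K * ((N : ℝ) + 2) ^ M)) := by ring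
    _ ≤ 2 * (2 ^ M * (K * ((N : ℝ) + 2) ^ M)) :=
        mul_le_mul_of_nonneg_right (by norm_num) (by positivity)
    _ = 2 ^ (M + 1) * (K * ((N : ℝ) + 2) ^ M) := by rw [pow_succ]; ring

/-- The ratio bound `σ_{N+1} < 2^{M+1} σ_N` (`K > 0`). [folklore] -/
theorem sigmaSeq_succ_lt {K : ℝ} (hK : 0 < K) (M N : ℕ) :
    sigmaSeq K M (N + 1) < 2 ^ (M + 1) * sigmaSeq K M N := by
  unfold sigmaSeq
  have hN : (0 : ℝ) ≤ N := Nat.cast_nonneg N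
  set x : ℝ := (N : ℝ) + 2 with hx
  have hx2 : 2 ≤ x := by rw [hx]; linarith
  have hcast : ((N + 1 : ℕ) : ℝ) + 2 = x + 1 := by rw [hx]; push_cast; ring
  rw [hcast]
  have hlogx : 0 < Real.log x := log_pos_of_two_le hx2
  -- `(x+1)^M ≤ 2^M x^M` and `log (x+1) < 2 log x` (as `x + 1 < x²`)
  have h1 : (x + 1) ^ M ≤ 2 ^ M * x ^ M := by
    rw [← mul_pow]; exact pow_le_pow_left₀ (by linarith) (by linarith) M
  have h2 : Real.log (x + 1) < 2 * Real.log x := by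
    rw [← Real.log_rpow (by linarith), Real.log_lt_log_iff (by linarith) (by positivity)]
    rw [show (2 : ℝ) = ((2 : ℕ) : ℝ) by norm_num, Real.rpow_natCast]
    nlinarith
  have hlog1 : 0 < Real.log (x + 1) := Real.log_pos (by linarith)
  calc K * ((x + 1) ^ M * Real.log (x + 1)) ≤ K * (2 ^ M * x ^ M * Real.log (x + 1)) := by
        gcongr
    _ < K * (2 ^ M * x ^ M * (2 * Real.log x)) := by
        gcongr
    _ = 2 ^ (M + 1) * (K * (x ^ M * Real.log x)) := by rw [pow_succ]; ring

end ExpGrid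

end Literature.NumberTheory.Transcendental

end
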